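import Summits.CriticalPhenomena.PercolationContinuityZ3.Theorems.PercNearOneGluingNoHeavyLowerTailSahiCombMixFiveSingle
import Summits.CriticalPhenomena.PercolationContinuityZ3.Theorems.PercNearOneGluingNoHeavyLowerTailSahiMomentExpansion

/-!
# The comb hierarchy for Sahi's `E_k`, LXX: the single-OR-ed family at EVERY `n` — slots, defect sets, defect moments, the touched-set recursion's
# ingredients, and the AFFINE cell (one touched slot) at every order

Support file of the one-cut programme (crux `NoHeavyLowerTail`, stmt-CriticalPhenomena-4575; cell `prim-masterthm`, seat P3, gen 11;
`run/shared/lean/prim/prim-masterthm/prim-masterthm-p3/HIERARCHY.md` §19(f)–(i), memo `run/shared/lean/prim/prim-masterthm/FROM-prim-masterthm-p3-g11-SINGLE-MEMBER-OR.md` §5–§7).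
Setting: `U : Fin n → Set (Set ι)` events of a finite cube ignoring `e`, a member `i`; the family `orCoord U e (sel i)` has `{e ∈ ω}` OR-ed into `U_i` alone.  A slot of a
row of its ∩-closed family (index set `K`) is TOUCHED when `i ∈ K`; then `1_{slot} = 1_Q − 1_Φ` with the PLAIN PART `Q = ⋂_{l∈K∖i} U_l` and the DEFECT SET
`Φ = (Q ∖ U_i) ∩ {e ∉ ω}` (`ind_slot_touched`); an untouched slot is the old member (`slotSet_untouched`).  The defect set misses every touched slot
(`phi_inter_slot_touched`), and against an event `A` ignoring `e` its moment is `μ_p(Φ ∩ A) = (1 − p_e)·μ_p((Q ∩ A) ∖ U_i)` (`ex_ind_phi_inter`), a comb-positive function of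
multidegree `δ_e + (1 off e)` (`combPos_exDiff_off`).  Hence (`ex_phi_prod`) the moments `E_p[1_Φ·Π_{j∈T} 1_{slot_j}]` that occur when the defect indicator is expanded in the
head slot by `SahiMomentExpansion.sahiE_cons_eq_moment_expansion_aux` VANISH if `T` contains a touched slot and equal `(1 − p_e)·μ_p((Q_x ∩ Q_T) ∖ U_i)` otherwise.
* **`sahiE_rowFam_affine`** — the AFFINE CELL at every order: if `x` is the only touched slot, `E_m(μ_p; slots) = p_e·E_m(μ_p; U-row with Q_x) + (1−p_e)·E_m(μ_p; U-row
  with U_i ∩ Q_x)` (multilinearity in slot `x`, the head-slot moment expansion applied to `1_Φ` and to `1_{Q∖U_i}`, whose moments differ exactly by the factor `1 − p_e`).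
Bookkeeping: `update_rowFam_erase/meet`, `rowFam_eq_plain`, `card_filter_succAbove`, `deg_step_le`, `deg_affine_le`.
Consumed by `…SahiCombMixSingleOrAll` (the single-member OR step for every `n`).  HONEST FRAMING: identities and bookkeeping; nothing here asserts (M⁺-k) or
`C_k` for `k ≥ 3`. [this work]
-/

noncomputable section

open scoped Classical

namespace Summit.CriticalPhenomena.PercolationContinuityZ3.Theorems

open Finset Function
open Literature.Combinatorics.Sahi2008
open Literature.Probability.Percolation.BHK2006 (ind_le_one ind_inter)
open Literature.Probability.Percolation.DecisionTree (ind ind_of_mem ind_of_not_mem ind_nonneg)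
open SahiComb
open SahiCombDisjunct (orCoord)
open SahiCombHereditary (CombHereditary)
open scoped Nat

variable {ι : Type} [Fintype ι]

namespace SahiCombMix

section SingleOr

variable {n : ℕ} (U : Fin n → Set (Set ι)) (e : ι) (i : Fin n) (hUe : ∀ (j : Fin n) (b : Bool), secAt e b (U j) = U j)

/-! ### Slots of the single-OR-ed family: the plain part `Q` and the defect set `Φ` -/

omit [Fintype ι] in
/-- An untouched slot (`i ∉ K`) is the old member `⋂_{l∈K} U_l`. [this work] -/
theorem slotSet_untouched (K : Finset (Fin n)) (hi : i ∉ K) : (⋂ l ∈ K, orCoord U e (sel i) l) = ⋂ l ∈ K, U l := by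
  rw [← Finset.erase_eq_of_notMem hi, biInter_orCoord_sel_erase]

omit [Fintype ι] in
/-- The indicator of a TOUCHED slot (`i ∈ K`): `1_{slot} = 1_{Q} − 1_{Φ}` with `Q = ⋂_{l∈K∖i} U_l` and `Φ = (Q ∖ U_i) ∩ {e ∉ ω}`. [this work] -/
theorem ind_slot_touched (K : Finset (Fin n)) (hi : i ∈ K) :
    ind (⋂ l ∈ K, orCoord U e (sel i) l)
      = ind (⋂ l ∈ K.erase i, U l) - ind (((⋂ l ∈ K.erase i, U l) \ U i) ∩ {ω : Set ι | e ∉ ω}) := by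
  funext ω
  rw [biInter_orCoord_sel, if_pos hi, Pi.sub_apply]
  by_cases hQ : ω ∈ ⋂ l ∈ K.erase i, U l
  · by_cases hU : ω ∈ U i
    · rw [ind_of_mem (show ω ∈ (⋂ l ∈ K.erase i, U l) ∩ (U i ∪ {ω : Set ι | e ∈ ω}) from ⟨hQ, Or.inl hU⟩), ind_of_mem hQ,
        ind_of_not_mem (show ω ∉ ((⋂ l ∈ K.erase i, U l) \ U i) ∩ {ω : Set ι | e ∉ ω} from fun h => h.1.2 hU)]
      ring
    · by_cases he : e ∈ ω
      · rw [ind_of_mem (show ω ∈ (⋂ l ∈ K.erase i, U l) ∩ (U i ∪ {ω : Set ι | e ∈ ω}) from ⟨hQ, Or.inr he⟩), ind_of_mem hQ,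
          ind_of_not_mem (show ω ∉ ((⋂ l ∈ K.erase i, U l) \ U i) ∩ {ω : Set ι | e ∉ ω} from fun h => h.2 he)]
        ring
      · rw [ind_of_not_mem (show ω ∉ (⋂ l ∈ K.erase i, U l) ∩ (U i ∪ {ω : Set ι | e ∈ ω}) from fun h => h.2.elim hU he), ind_of_mem hQ,
          ind_of_mem (show ω ∈ ((⋂ l ∈ K.erase i, U l) \ U i) ∩ {ω : Set ι | e ∉ ω} from ⟨⟨hQ, hU⟩, he⟩)]
        ring
  · rw [ind_of_not_mem (show ω ∉ (⋂ l ∈ K.erase i, U l) ∩ (U i ∪ {ω : Set ι | e ∈ ω}) from fun h => hQ h.1), ind_of_not_mem hQ,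
      ind_of_not_mem (show ω ∉ ((⋂ l ∈ K.erase i, U l) \ U i) ∩ {ω : Set ι | e ∉ ω} from fun h => hQ h.1.1)]
    ring

omit [Fintype ι] in
/-- The defect set of a touched slot misses EVERY touched slot. [this work] -/
theorem phi_inter_slot_touched (K K' : Finset (Fin n)) (hi' : i ∈ K') :
    (((⋂ l ∈ K.erase i, U l) \ U i) ∩ {ω : Set ι | e ∉ ω}) ∩ (⋂ l ∈ K', orCoord U e (sel i) l) = ∅ := by
  rw [biInter_orCoord_sel, if_pos hi']
  refine Set.eq_empty_iff_forall_notMem.2 fun ω h => ?_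
  rcases h.2.2 with h' | h'
  · exact h.1.1.2 h'
  · exact h.1.2 h'

omit [Fintype ι] in
/-- `ind ∅ = 0`. [folklore] -/
theorem ind_empty_fun {β : Type*} : ind (∅ : Set β) = 0 := by
  funext b; simp [ind]

/-- `E[0] = 0`. [folklore] -/
theorem ex_zero_fun {β : Type*} [Fintype β] (μ : β → ℝ) : ex μ (0 : β → ℝ) = 0 := by
  simp [ex_def]

omit [Fintype ι] in
/-- Indicator of a difference `A ∖ B` as `1_A − 1_{B ∩ A}`. [folklore] -/
theorem ind_diff_eq (A B : Set (Set ι)) : ind (A \ B) = ind A - ind (B ∩ A) := by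
  funext ω
  rw [Pi.sub_apply]
  by_cases hA : ω ∈ A
  · by_cases hB : ω ∈ B
    · rw [ind_of_not_mem (show ω ∉ A \ B from fun h => h.2 hB), ind_of_mem hA, ind_of_mem (show ω ∈ B ∩ A from ⟨hB, hA⟩)]; ring
    · rw [ind_of_mem (show ω ∈ A \ B from ⟨hA, hB⟩), ind_of_mem hA, ind_of_not_mem (show ω ∉ B ∩ A from fun h => hB h.1)]; ring
  · rw [ind_of_not_mem (show ω ∉ A \ B from fun h => hA h.1), ind_of_not_mem hA, ind_of_not_mem (show ω ∉ B ∩ A from fun h => hA h.2)]; ring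

omit [Fintype ι] in
/-- Sections commute with finite intersections of a family. [folklore] -/
theorem secAt_biInter_fam {κ : Type*} (V : κ → Set (Set ι)) (T : Finset κ) (b : Bool) :
    secAt e b (⋂ j ∈ T, V j) = ⋂ j ∈ T, secAt e b (V j) := by
  ext ω
  simp only [mem_secAt, Set.mem_iInter]

omit [Fintype ι] in
/-- Sections commute with set difference. [folklore] -/
theorem secAt_sdiff (b : Bool) (A B : Set (Set ι)) : secAt e b (A \ B) = secAt e b A \ secAt e b B := by
  cases b <;> rfl

include hUe in
/-- **Moments against the defect set**: for an event `A` ignoring `e`, `μ_p(((Q∖U_i) ∩ {e∉ω}) ∩ A) = (1 − p_e)·(μ_p(Q ∩ A) − μ_p(U_i ∩ (Q ∩ A)))`. [this work] -/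
theorem ex_ind_phi_inter (K : Finset (Fin n)) (A : Set (Set ι)) (hA : ∀ b : Bool, secAt e b A = A) (p : ι → unitInterval) :
    ex (bernoulliWeight p) (ind ((((⋂ l ∈ K.erase i, U l) \ U i) ∩ {ω : Set ι | e ∉ ω}) ∩ A))
      = (1 - (p e : ℝ)) * (ex (bernoulliWeight p) (ind ((⋂ l ∈ K.erase i, U l) ∩ A))
          - ex (bernoulliWeight p) (ind (U i ∩ ((⋂ l ∈ K.erase i, U l) ∩ A)))) := by
  have hQ : ∀ b : Bool, secAt e b (⋂ l ∈ K.erase i, U l) = ⋂ l ∈ K.erase i, U l := fun b => secAt_biInter U e hUe _ b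
  have h1 : secAt e true ((((⋂ l ∈ K.erase i, U l) \ U i) ∩ {ω : Set ι | e ∉ ω}) ∩ A) = ∅ := by
    refine Set.eq_empty_iff_forall_notMem.2 fun ω h => ?_
    rw [mem_secAt] at h
    exact h.1.2 (show e ∈ forceAt e true ω from Set.mem_insert e ω)
  have h0 : secAt e false ((((⋂ l ∈ K.erase i, U l) \ U i) ∩ {ω : Set ι | e ∉ ω}) ∩ A)
      = ((⋂ l ∈ K.erase i, U l) ∩ A) \ U i := by
    rw [secAt_inter, secAt_inter, secAt_sdiff, hQ, hUe, hA]
    ext ω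
    constructor
    · intro h; exact ⟨⟨h.1.1.1, h.2⟩, h.1.1.2⟩
    · intro h
      refine ⟨⟨⟨h.1.1, h.2⟩, ?_⟩, h.1.2⟩
      rw [mem_secAt]
      show e ∉ forceAt e false ω
      simp [forceAt]
  rw [SahiCombDisjunct.ex_ind_of_secAt p e h1 h0, ind_empty_fun, ex_zero_fun, mul_zero, zero_add, ind_diff_eq, SahiCombDisjunct.ex_sub']

/-- **Defect moments are comb-positive at multidegree `1` off `e`**: `p ↦ μ_p(A) − μ_p(B ∩ A) = μ_p(A ∖ B)` for events ignoring `e`. [this work] -/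
theorem combPos_exDiff_off (A B : Set (Set ι)) (hA : ∀ b : Bool, secAt e b A = A) (hB : ∀ b : Bool, secAt e b B = B) :
    CombPos (update (fun _ : ι => 1) e 0)
      (fun p => ex (bernoulliWeight p) (ind A) - ex (bernoulliWeight p) (ind (B ∩ A))) := by
  have hAB : ∀ b : Bool, secAt e b (A \ B) = A \ B := fun b => by rw [secAt_sdiff, hA, hB]
  have h0 := (combPos_ex_ind (A \ B)).of_ignores e fun p s =>
    SahiCombDisjunct.ex_update_of_ignores' e (fun ω => by rw [← hAB true]; exact ind_secAt_insert e true _ ω) p s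
  refine h0.congr fun p => ?_
  rw [ind_diff_eq, SahiCombDisjunct.ex_sub']

/-! ### The row family of the single-OR-ed family and its plain modifications -/

omit [Fintype ι] in
/-- Making a touched slot plain: replacing slot `x` by `1_{Q_x}` gives the row family of the slot map `K[x ↦ K_x ∖ i]`. [this work] -/
theorem update_rowFam_erase {m : ℕ} (K : Fin m → Finset (Fin n)) (x : Fin m) :
    update (fun j => ind (⋂ l ∈ K j, orCoord U e (sel i) l)) x (ind (⋂ l ∈ (K x).erase i, U l))
      = fun j => ind (⋂ l ∈ update K x ((K x).erase i) j, orCoord U e (sel i) l) := by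
  funext j
  by_cases hj : j = x
  · subst hj; rw [update_self, update_self, biInter_orCoord_sel_erase]
  · rw [update_of_ne hj, update_of_ne hj]

omit [Fintype ι] in
/-- With no touched slot the row family is a row family of `U`. [this work] -/
theorem rowFam_eq_plain {m : ℕ} (K : Fin m → Finset (Fin n)) (h : ∀ j, i ∉ K j) :
    (fun j => ind (⋂ l ∈ K j, orCoord U e (sel i) l)) = fun j => ind (⋂ l ∈ K j, U l) := by
  funext j; rw [slotSet_untouched U e i (K j) (h j)]

omit [Fintype ι] in
/-- Replacing the only touched slot `x` by `1_{U_i ∩ Q_x}` gives the row family of `U` with the same slot map. [this work] -/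
theorem update_rowFam_meet {m : ℕ} (K : Fin m → Finset (Fin n)) (x : Fin m) (hx : i ∈ K x) (h : ∀ j, j ≠ x → i ∉ K j) :
    update (fun j => ind (⋂ l ∈ K j, orCoord U e (sel i) l)) x (ind (U i ∩ ⋂ l ∈ (K x).erase i, U l))
      = fun j => ind (⋂ l ∈ K j, U l) := by
  funext j
  by_cases hj : j = x
  · subst hj
    rw [update_self]
    conv_rhs => rw [← Finset.insert_erase hx, Finset.set_biInter_insert]
  · rw [update_of_ne hj, slotSet_untouched U e i (K j) (h j hj)]

/-- Counting touched slots after removing slot `x`. [folklore] -/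
theorem card_filter_succAbove {m : ℕ} (P : Fin (m + 1) → Prop) [DecidablePred P] (x : Fin (m + 1)) (hx : P x) :
    (univ.filter fun y : Fin m => P (x.succAbove y)).card + 1 = (univ.filter P).card := by
  rw [Finset.card_filter, Finset.card_filter, Fin.sum_univ_succAbove _ x, if_pos hx]
  ring

omit [Fintype ι] in
/-- Degree bookkeeping for the recursion terms: `(δ_e + (1 off e)) + c ≤ m' + 1` when `c ≤ m'`. [folklore] -/
theorem deg_step_le (m' c : ℕ) (hc : c ≤ m') :
    (Pi.single e 1 + update (fun _ : ι => (1 : ℕ)) e 0) + (fun _ : ι => c) ≤ fun _ : ι => m' + 1 := by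
  intro z
  by_cases hz : z = e
  · subst hz; simp; omega
  · simp [hz]; omega

omit [Fintype ι] in
/-- Degree bookkeeping for the affine cell: `δ_e + (m off e) ≤ m`. [folklore] -/
theorem deg_affine_le (m : ℕ) : (Pi.single e 1 + update (fun _ : ι => m + 1) e 0) ≤ fun _ : ι => m + 1 := by
  intro z
  by_cases hz : z = e
  · subst hz; simp
  · simp [hz]

include hUe in
/-- **The defect moments of the recursion.**  For the touched slot `x` of a slot map `K` on `m + 1` slots and a set `T` of OTHER slots (indexed
through `x.succAbove`): if `T` contains a touched slot the moment `E_p[1_{Φ_x}·Π_{j∈T} 1_{slot_j}]` vanishes; otherwise it is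
`(1 − p_e)·μ_p((Q_x ∩ Q_T) ∖ U_i)`. [this work] -/
theorem ex_phi_prod {m : ℕ} (K : Fin (m + 1) → Finset (Fin n)) (x : Fin (m + 1)) (T : Finset (Fin m)) (p : ι → unitInterval) :
    ex (bernoulliWeight p) (ind ((((⋂ l ∈ (K x).erase i, U l) \ U i) ∩ {ω : Set ι | e ∉ ω}))
        * ∏ j ∈ T, ind (⋂ l ∈ K (x.succAbove j), orCoord U e (sel i) l))
      = if ∃ y ∈ T, i ∈ K (x.succAbove y) then 0 else
        (1 - (p e : ℝ)) * (ex (bernoulliWeight p) (ind ((⋂ l ∈ (K x).erase i, U l) ∩ ⋂ j ∈ T, ⋂ l ∈ K (x.succAbove j), U l))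
          - ex (bernoulliWeight p) (ind (U i ∩ ((⋂ l ∈ (K x).erase i, U l) ∩ ⋂ j ∈ T, ⋂ l ∈ K (x.succAbove j), U l)))) := by
  rw [finsetProd_ind_eq_ind_biInter (fun j => ⋂ l ∈ K (x.succAbove j), orCoord U e (sel i) l) T,
    show ind ((((⋂ l ∈ (K x).erase i, U l) \ U i) ∩ {ω : Set ι | e ∉ ω}))
        * ind (⋂ j ∈ T, ⋂ l ∈ K (x.succAbove j), orCoord U e (sel i) l)
      = ind (((((⋂ l ∈ (K x).erase i, U l) \ U i) ∩ {ω : Set ι | e ∉ ω})) ∩ ⋂ j ∈ T, ⋂ l ∈ K (x.succAbove j), orCoord U e (sel i) l)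
      from by funext ω; rw [Pi.mul_apply]; exact (ind_inter _ _ ω).symm]
  split_ifs with hT
  · obtain ⟨y, hyT, hy⟩ := hT
    have hsub : (((⋂ l ∈ (K x).erase i, U l) \ U i) ∩ {ω : Set ι | e ∉ ω}) ∩ (⋂ j ∈ T, ⋂ l ∈ K (x.succAbove j), orCoord U e (sel i) l)
        ⊆ (((⋂ l ∈ (K x).erase i, U l) \ U i) ∩ {ω : Set ι | e ∉ ω}) ∩ (⋂ l ∈ K (x.succAbove y), orCoord U e (sel i) l) :=
      Set.inter_subset_inter_right _ fun ω hω => (Set.mem_iInter₂.1 hω) y hyT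
    rw [phi_inter_slot_touched U e i (K x) (K (x.succAbove y)) hy, Set.subset_empty_iff] at hsub
    rw [hsub, ind_empty_fun, ex_zero_fun]
  · have hun : ∀ y ∈ T, i ∉ K (x.succAbove y) := fun y hy hi => hT ⟨y, hy, hi⟩
    have hV : (⋂ j ∈ T, ⋂ l ∈ K (x.succAbove j), orCoord U e (sel i) l) = ⋂ j ∈ T, ⋂ l ∈ K (x.succAbove j), U l :=
      Set.iInter_congr fun j => Set.iInter_congr fun hj => slotSet_untouched U e i _ (hun j hj)
    rw [hV]
    have hA : ∀ b : Bool, secAt e b (⋂ j ∈ T, ⋂ l ∈ K (x.succAbove j), U l) = ⋂ j ∈ T, ⋂ l ∈ K (x.succAbove j), U l := by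
      intro b
      rw [secAt_biInter_fam]
      exact Set.iInter_congr fun j => Set.iInter_congr fun _ => secAt_biInter U e hUe _ b
    exact ex_ind_phi_inter U e i hUe (K x) _ hA p

include hUe in
/-- **THE AFFINE CELL (one touched slot), every order**: if `x` is the only touched slot of `K`, then
`E_{m+1}(μ_p; slots) = p_e·E_{m+1}(μ_p; U-row of K[x ↦ K_x∖i]) + (1 − p_e)·E_{m+1}(μ_p; U-row of K)`. [this work] -/
theorem sahiE_rowFam_affine {m : ℕ} (K : Fin (m + 1) → Finset (Fin n)) (x : Fin (m + 1)) (hx : i ∈ K x) (h : ∀ j, j ≠ x → i ∉ K j)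
    (p : ι → unitInterval) :
    sahiE (bernoulliWeight p) (m + 1) (fun j => ind (⋂ l ∈ K j, orCoord U e (sel i) l))
      = (p e : ℝ) * sahiE (bernoulliWeight p) (m + 1) (fun j => ind (⋂ l ∈ update K x ((K x).erase i) j, U l))
        + (1 - (p e : ℝ)) * sahiE (bernoulliWeight p) (m + 1) (fun j => ind (⋂ l ∈ K j, U l)) := by
  set μ := bernoulliWeight p with hμ
  set F : Fin (m + 1) → Set ι → ℝ := fun j => ind (⋂ l ∈ K j, orCoord U e (sel i) l) with hF
  set Q : Set (Set ι) := ⋂ l ∈ (K x).erase i, U l with hQ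
  set Φ : Set (Set ι) := (Q \ U i) ∩ {ω : Set ι | e ∉ ω} with hΦ
  -- slot `x` decomposed: `F_x = 1_Q − 1_Φ`
  have hFx : update F x ((1 : ℝ) • ind Q + (-1 : ℝ) • ind Φ) = F := by
    rw [show (1 : ℝ) • ind Q + (-1 : ℝ) • ind Φ = ind Q - ind Φ from by funext ω; simp; ring,
      ← ind_slot_touched U e i (K x) hx]
    exact update_eq_self x F
  have hlin := sahiE_update_lin μ (m + 1) F x 1 (-1) (ind Q) (ind Φ)
  rw [hFx] at hlin
  -- the `Q`-modified row and the `U_i ∩ Q`-modified row are `U`-rows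
  have hKQ : ∀ j, i ∉ update K x ((K x).erase i) j := by
    intro j; by_cases hj : j = x
    · subst hj; rw [update_self]; exact Finset.notMem_erase i _
    · rw [update_of_ne hj]; exact h j hj
  have hQrow : sahiE μ (m + 1) (update F x (ind Q)) = sahiE μ (m + 1) (fun j => ind (⋂ l ∈ update K x ((K x).erase i) j, U l)) := by
    rw [hF, hQ, update_rowFam_erase U e i K x, rowFam_eq_plain U e i _ hKQ]
  have hProw : sahiE μ (m + 1) (update F x (ind (U i ∩ Q))) = sahiE μ (m + 1) (fun j => ind (⋂ l ∈ K j, U l)) := by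
    rw [hF, hQ, update_rowFam_meet U e i K x hx h]
  -- the `Φ`-row carries the factor `(1 − p_e)` relative to the `(Q ∖ U_i)`-row: move `x` to the head and expand both
  have hnone : ∀ (T : Finset (Fin m)), ¬ ∃ y ∈ T, i ∈ K (x.succAbove y) := fun T ⟨y, _, hy⟩ => h _ (Fin.succAbove_ne x y) hy
  have hremove : x.removeNth F = fun j => ind (⋂ l ∈ K (x.succAbove j), orCoord U e (sel i) l) := rfl
  have hmom : ∀ T : Finset (Fin m), ex μ (ind Φ * ∏ j ∈ T, x.removeNth F j)
      = (1 - (p e : ℝ)) * ex μ (ind (Q \ U i) * ∏ j ∈ T, x.removeNth F j) := by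
    intro T
    rw [hremove, hΦ, hQ, hμ, ex_phi_prod U e i hUe K x T p, if_neg (hnone T)]
    have hV : (⋂ j ∈ T, ⋂ l ∈ K (x.succAbove j), orCoord U e (sel i) l) = ⋂ j ∈ T, ⋂ l ∈ K (x.succAbove j), U l :=
      Set.iInter_congr fun j => Set.iInter_congr fun hj => slotSet_untouched U e i _ (fun hi => hnone T ⟨j, hj, hi⟩)
    rw [finsetProd_ind_eq_ind_biInter (fun j => ⋂ l ∈ K (x.succAbove j), orCoord U e (sel i) l) T, hV,
      show ind ((⋂ l ∈ (K x).erase i, U l) \ U i) * ind (⋂ j ∈ T, ⋂ l ∈ K (x.succAbove j), U l)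
          = ind (((⋂ l ∈ (K x).erase i, U l) ∩ ⋂ j ∈ T, ⋂ l ∈ K (x.succAbove j), U l) \ U i) from by
        funext ω; rw [Pi.mul_apply, ← ind_inter]; congr 1; ext ω'
        simp only [Set.mem_inter_iff, Set.mem_sdiff]; tauto,
      ind_diff_eq, SahiCombDisjunct.ex_sub']
  have hΦrow : sahiE μ (m + 1) (update F x (ind Φ)) = (1 - (p e : ℝ)) * sahiE μ (m + 1) (update F x (ind (Q \ U i))) := by
    rw [SahiMeetTowerAll.sahiE_update_eq_sahiE_cons, SahiMeetTowerAll.sahiE_update_eq_sahiE_cons,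
      SahiMomentExpansion.sahiE_cons_eq_moment_expansion_aux, SahiMomentExpansion.sahiE_cons_eq_moment_expansion_aux]
    simp_rw [hmom]
    rw [mul_sub, Finset.mul_sum]
    congr 1
    · ring
    · exact Finset.sum_congr rfl fun T _ => by ring
  have hDrow : sahiE μ (m + 1) (update F x (ind (Q \ U i)))
      = sahiE μ (m + 1) (update F x (ind Q)) - sahiE μ (m + 1) (update F x (ind (U i ∩ Q))) := by
    rw [ind_diff_eq, show ind Q - ind (U i ∩ Q) = (1 : ℝ) • ind Q + (-1 : ℝ) • ind (U i ∩ Q) from by funext ω; simp; ring,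
      sahiE_update_lin]
    ring
  rw [← hQrow, ← hProw]
  rw [hlin, hΦrow, hDrow]
  ring

end SingleOr

end SahiCombMix

end Summit.CriticalPhenomena.PercolationContinuityZ3.Theorems

end
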